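import Summits.AtomisticToContinuum.Crystallization.Theorems.ChartedZeroExcessLayeredLatticeLiouvilleYW

/-!
# Part YX «ShadowReference» (lens-2 g73): the reference IS a placed perfect crystal SHADOWING the chart — F18 repair of g72; pieces (XR♮) / (Gl♮) / (Gp♮) / (Gh♮)

Docket `stmt-AtomisticToContinuum-26636` (N = `…Theses.ChartedPlanarOrder.ChartedZeroExcessLayered`), cell decomp-a2c RESIDUAL MODE, lens-2
«structural dichotomy (special vs generic)», generation 73.  Imports part YW (g72; with YV the line of record 72R, critic row 1303, landed p852782 /
p852789).  REPAIRS 72R: the g72 MOVE is kept — the lens one level up, on the REFERENCE CLASS: the reference `y₀` IS the site list of a placed perfect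
clamped patch, so the comparison map is the identity, pair relations are literally shared and only the interface class needs a sandwich — but the
REFERENCE PREDICATE is RE-TYPED after the planner's own audit of NODE 72 found the placed-perfect-patch class EMPTY on an admissible corner of the binders
(F18 below, PROVED against the tree's own `IsPlacedPerfectPatch` / `RigidReferenceP`).  This part: the F18 lemmas (PROVED), the repaired predicate
`IsPlacedShadowPatch σ ϑr H X′ Y` (+ `_self`, `.mono`, PROVED) and the four re-typed pieces; the engines, class currencies, `IsFatPatch`,
`IsCollarRegistered` of part YV are USED, not copied; part YY: the junctions down to (QE) (all PROVED, verbatim from YW modulo the predicate).  0 sorry.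

## F18 — the separation/scale ceiling of g72's `IsPlacedPerfectPatch aHi δ θ a s Λ` ((XR♯) FALSE AS TYPED; planner self-audit, PROVED reduction)
g72 asked the placed reference crystal `H′` to be an `aHi`-door set at the BINDERS' separation `δ` (`IsSep δ H′`) AND an equilibrium chart at the BINDERS'
scale `a` (`IsConfChart a s L′`: `‖L′ v₁‖ ≤ (1 + s)·a`).  The two lattice points `w′ 0`, `L′ v₁ + w′ 0` then force `δ ≤ (1 + s)·a`
(`not_isSep_layeredHom_of_isConfChart`, PROVED here) — but the binders of (QE) do NOT bound `δ` by `a`: read any equilibrium chart `H = λ·Q(fcc)` at the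
bottom of its conformal range, `a := λ/(1 + s)`, and take for `S` ANY admissible door set of separation `δ > λ` — `K = ∅` (tameness vacuous), or the
NON-degenerate `S := (1 + η)·H`, `0 < η ≤ ϑc/4` (every `4`-star of `S` is `ϑc`-tame into `H` via `p ↦ p/(1 + η)`), `δ := (1 + η)·λ`.  On these instances no
placed perfect patch exists at all, so (XR♯) `RigidReferenceP` fails at every value of its dials (§YX-1: `IsPlacedPerfectPatch.sep_le`,
`SepCeilingWitnessP → ¬ RigidReferenceP`, PROVED).  Class MISSTATED, not substantive: YW never destructures the door-set / θ-good / summable /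
equilibrium clauses of the reference (they are passed to (Gl♯) as a black box), so the repair is DEFINITIONAL and every junction proof survives verbatim
(part YY).  The cheaper patch «`∃ δ′ > 0, IsDoorSetP aHi δ′ H′`» (un-tying only `δ`) is NOT taken: it would keep demanding that the (XR) prover EXHIBIT
an exactly Nash (`IsNash`: global single-site optimality), clean, charted equilibrium crystal containing the collar's stacking word — an implicit-function
relaxation of the interlayer spacings of an arbitrary finite Barlow word plus a global one-site minimisation, i.e. an ANALYTIC/CERT burden inside a piece
tagged KINEMATIC (row 1303), and it would leave the conformal tie `λ′ ∈ [(1 − s)a, (1 + s)a]` coupled to the registration budget `ε`.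

## The repair — SHADOWING instead of door-set membership (why this typing, and not the three nearby ones)
`IsPlacedShadowPatch σ ϑr H X′ Y` (§YX-2): `X′ ∪ range Y = g '' H₀`, `g` an isometry, `H₀ = LayeredHom L′ w′` a rooted layered crystal that is
`σ`-SEPARATED and whose every radius-`4` environment is TWO-SIDEDLY `ϑr`-close by translation (`EnvClose`, part MesoCut) to an environment of the BINDER
chart crystal `H = LayeredHom L w`.  (a) Nothing of `(δ, a, aHi, θ)` is imposed (kills F18; `isPlacedShadowPatch_self` PROVES the class inhabited by `H`
itself, `27/32`-separated by the tree's `isSep_layeredHom_of_isEquilChart`).  (b) No Nash / equilibrium / summability demanded of `H₀`: the (XR♮) prover's task is KINEMATIC (read the collar's stacking letters and heights —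
determined up to `O(ϑc)` by `ϑc`-coolness into `H` — continue the word upward/downward by the `4`-windows of `H` at the positions where the top/bottom
collar stars map, place by the John-synthesised frame), whereas «reference = some equilibrium chart» would ask an existence prover to exhibit an EXACTLY
Nash polytype containing the collar word (an implicit-function relaxation — analytic, mis-placed in an ∃-piece), «reference = the chart `H` moved
rigidly» is FALSE for aperiodic chart words (a collar cool into `w = (h⁹c⁹)^∞` may spell `h⁹c¹⁸`), and «ideal Barlow stacking» is false by the hcp `c/a`
misfit (`~10⁻³`/layer ≫ ε over 16 layers).  (c) Two-sided `EnvClose` (not the one-sided `IsTameStar`) excludes rows and monolayers — one-sidedly tame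
into fcc, mechanically unstable — and `σ` excludes doubled sites; both would make (Gl♮) false.  (d) ALL crystal physics moves into the ONE
configuration-free piece (Gl♮), now quantified over the equilibrium chart `H` being shadowed (`∀ a L w, IsEquilChart a s Λ L w →`): Born stability and
Green rows of near-equilibrium close packings, uniformly over words and the chart window — exactly the census «GreenRow-T» object, fattened by `ϑr`.

## The pieces (this part; tags) — node (Gh♮) ⟸ (Gl♮) ∧ (Gp♮) ∧ Neumann-1 and the chain to (QE) are PROVED in part YY
  (XR♮) `ShadowReferenceP … σ ϑr ε Rl Ru …`               [SPECIAL∃ · KINEMATIC · ATTACKABLE · STRONGER than (XR) (YY: PROVED ⇒ (XR)) · «ShadowFit-T»]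
  (Gl♮) `ShadowPatchResponseP q ρi ρo σ ϑr Rl Ru Rg Rφ G … Λ s` [SPECIAL · CERT-type · CONFIGURATION-FREE · FAT shadow patches of equilibrium charts ·
                                                  every sandwiched interface class · «GreenRow-T(shadow, band)»]
  (Gp♮) `ShadowPinDriftP … Rφ σ ϑr ε Rl Ru κ …`            [GENERIC · ANALYTIC · FORWARD · ATTACKABLE · site-diagonal pin mismatch, `κg = 0` admissible · «PinDrift-R»]
  (Gh♮) `ShadowHarmonicResponseP … Rφ σ ϑr ε Rl Ru H …`     [(Gh) of part YS RESTRICTED to shadow collar-registered references; WEAKER than (Gh) (YY: PROVED)]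
* `A` IS PINNED, NOT CHOSEN: (Gl♮) produces `∃ A, HasFDerivAt (D E_{X′}) A Y` at a shadow patch; (Gp♮) consumes `∀ A, HasFDerivAt … A y₀ →`.
* FATNESS IS DERIVED, NOT ASSUMED (the tree's `isFatPatch_of_collarRegistered`, part YW, called in YY): inner radius `ρ − ε` from (M2), outer radius `ρ + dm` from the
  matching clause of `IsTubeReference`.
* The g72 rationale for the level-up stands unchanged (row 1295 Gr-1/2/3: shared pair relations; one frame by fiat at the price `ε, ϑ₀ ≈ (ϑc/4)(ρ + Rg)`,
  free in the `∃ ϑm` column `_16XH28BVT` via `VariationalMildDocket.of_le`, NOT at the record `ϑm = 1/2000`; no empty `Rg` window).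

## Pre-registered forecast (not a verdict; census «GreenRow-T(shadow, band)» G, «ShadowFit-T» (σ, ϑr, ε) and «PinDrift-R» κ decide)
Dials: `σ = 3/4` (clean charts: nearest neighbours `≥ 0.9·(1 − 2/16) = 0.7875`), `ϑr = ε = ϑ₀ = 10⁻⁴` (`≥ 5ϑc`; John synthesis of the `ϑc`-cool shell),
`Rg = Rφ = 5`, `(sb, dI, dB) = (3/400, 3/400, 3/10)`, band `[Rl, Ru] = [19/4, 21/4]`, `qN = 1/2`, moat dial `ϑm ≈ 10⁻⁵`.  LJ: `V″(0.971) = 10.8`,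
`|V‴| ≈ 210`; `κI/dI ≈ 1200·ε + 2π(3.5 + t) ≈ 0.33`, `κb/dB ≈ 4.4·10⁻³` at `Rg = 5`, `κg = 0`; g70 rows `GI_I ≈ 0.3`, `GI_b ≈ 3`, `GB_b ≈ 25`; open number `GB_I`.
AUDIT NOTE (lineage-wide, flagged not fixed here): the chart family admits the dilated corner of the clean scale window (nearest neighbour up to
`≈ 1.06 a₀`); (Gl♮)/(X1) as `∀`-claims need Born stability there too — census rows should include the window corners.

## Sources
parts YO ((XR), `IsTubeReference`), YOA (tube), YP, YQ v2 (currency), YS ((Gh), `mem_bondTube_of_forall_gt`), MesoCut (`EnvClose`), O (`IsConfChart`),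
YV/YW of g72 (p852782 / p852789: `IsPlacedPerfectPatch`, `RigidReferenceP`, engines, currencies, `IsFatPatch`, `IsCollarRegistered`), TF
(`isSep_layeredHom_of_isEquilChart`), YI (`VariationalMildDocket.of_le`, column `_16XH28BVT`); E–Ming, ARMA 183 (2007) §2;
Ortner–Theil, ARMA 207 (2013) §6; Ehrlacher–Ortner–Shapeev, ARMA 222 (2016); Braun–Schmidt arXiv:1604.00197; F. John, CPAM 14 (1961); CRITIC-LEDGER rows
1272, 1274, 1283, 1295, 1303; NODE-g72 (STATUS l.6423).
-/

noncomputable section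
open scoped BigOperators Classical InnerProductSpace RealInnerProductSpace
open MeasureTheory Set Metric Filter Topology
open Summit.AtomisticToContinuum.Crystallization.Theorems.ChartedPlanarOrderRigidityDoor (E3 eStar atomsIn IsEStarGSC siteEnergy VisibleGap PertRegime)
open Summit.AtomisticToContinuum.Crystallization.Theorems.ChartedPlanarOrderDensityDichotomy (μS IsSep nK nK_nonneg)
open Summit.AtomisticToContinuum.Crystallization.Theorems.ChartedPlanarOrderCleanScaleP (IsCleanP IsDoorSetP)
open Summit.AtomisticToContinuum.Crystallization.Theorems.ChartedPlanarOrderMesoCut (LayeredHom EnvClose)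
open Summit.AtomisticToContinuum.Crystallization.Theorems.ChartedPlanarOrderDoorLayered (atomsIn_subset sq_le_finsum_mem PeriodicBulkGapDoor)
open Summit.AtomisticToContinuum.Crystallization.Theorems.ChartedPlanarOrderDoorLayeredOsc (IsTwoShellAffineGood)
open Literature.MathematicalPhysics.StatisticalMechanics (card_le_of_separated_of_dist_le lennardJones interactionEnergy triangularVec₁)

namespace Summit.AtomisticToContinuum.Crystallization.Theorems.ChartedZeroExcessLayeredLatticeLiouville

/-! ### YX-1  F18 (PROVED) and the repaired reference class: placed SHADOW patches (fatness `IsFatPatch`, registration `IsCollarRegistered`, engines and class currencies are the tree's, part YV) -/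

section ShadowReference

variable {n : ℕ}

/-- `‖(1, 0, 0)‖ = 1`. [folklore] -/
private theorem norm_triangularVec₁_one : ‖(triangularVec₁ 1 : E3)‖ = 1 := by
  rw [EuclideanSpace.norm_eq, Fin.sum_univ_three]
  simp [triangularVec₁]

/-- ★ **F18 MECHANISM (PROVED) — why the reference crystal must NOT be tied to the binders' `(δ, a)`**: an invertible chart that is `s`-conformal about
the scale `a ≥ 0` has the two lattice points `w 0`, `L v₁ + w 0` at distance `‖L v₁‖ ≤ (1 + s)·a`, so its crystal is NOT `δ`-separated for any
`δ > (1 + s)·a`.  The retired g72 predicate `IsPlacedPerfectPatch aHi δ θ a s Λ` asked the placed crystal to be an `aHi`-door set at the BINDERS' `δ`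
AND an equilibrium chart at the BINDERS' `a`, hence `δ ≤ (1 + s)·a` — but the binders of (QE) admit `δ > (1 + s)·a` (a chart read at the bottom of its
conformal scale range `a = λ/(1 + s)` with any door set of separation `> λ`, e.g. the `(1 + η)`-dilated tame copy `S = (1 + η)·H`, `η ≤ ϑc/4`), so g72's
(XR♯) `RigidReferenceP` is FALSE AS TYPED (`not_rigidReferenceP_of_sepCeilingWitness` below, PROVED). [this file, g73] -/
theorem not_isSep_layeredHom_of_isConfChart {a s δ : ℝ} {L : E3 ≃L[ℝ] E3} (w : ℤ → E3)
    (hL : IsConfChart a s (L : E3 →L[ℝ] E3)) (ha : 0 ≤ a) (hδ : (1 + s) * a < δ) :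
    ¬ IsSep δ (LayeredHom (L : E3 →L[ℝ] E3) w) := by
  intro hsep
  obtain ⟨Q, hQ⟩ := hL
  have hv1 : ‖(triangularVec₁ 1 : E3)‖ = 1 := norm_triangularVec₁_one
  have hP0 : w 0 ∈ LayeredHom (L : E3 →L[ℝ] E3) w := ⟨0, 0, 0, by simp⟩
  have hP1 : (L : E3 →L[ℝ] E3) (triangularVec₁ 1) + w 0 ∈ LayeredHom (L : E3 →L[ℝ] E3) w := ⟨0, 1, 0, by simp⟩
  have hLv : (L : E3 →L[ℝ] E3) (triangularVec₁ 1) ≠ 0 := by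
    intro h
    have h0 : (triangularVec₁ 1 : E3) = 0 := by
      have := L.injective (show L (triangularVec₁ 1) = L 0 by simpa using h)
      simpa using this
    have : ‖(triangularVec₁ 1 : E3)‖ = 0 := by rw [h0, norm_zero]
    linarith
  have hne : w 0 ≠ (L : E3 →L[ℝ] E3) (triangularVec₁ 1) + w 0 := by
    intro h
    apply hLv
    have h' : (L : E3 →L[ℝ] E3) (triangularVec₁ 1) + w 0 = 0 + w 0 := by rw [zero_add]; exact h.symm
    exact add_right_cancel h'
  have hd := hsep _ hP0 _ hP1 hne
  have hdist : dist (w 0) ((L : E3 →L[ℝ] E3) (triangularVec₁ 1) + w 0) = ‖(L : E3 →L[ℝ] E3) (triangularVec₁ 1)‖ := by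
    rw [dist_comm, dist_eq_norm, add_sub_cancel_right]
  have hQv : ‖(Q.toContinuousLinearEquiv : E3 →L[ℝ] E3) (triangularVec₁ 1)‖ = 1 := by
    have h := Q.norm_map (triangularVec₁ 1 : E3)
    rw [hv1] at h
    simpa using h
  have hdiff : ‖((L : E3 →L[ℝ] E3) - a • (Q.toContinuousLinearEquiv : E3 →L[ℝ] E3)) (triangularVec₁ 1)‖ ≤ s * a := by
    have h := ContinuousLinearMap.le_opNorm ((L : E3 →L[ℝ] E3) - a • (Q.toContinuousLinearEquiv : E3 →L[ℝ] E3)) (triangularVec₁ 1)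
    rw [hv1, mul_one] at h
    exact h.trans hQ
  have hsum : (L : E3 →L[ℝ] E3) (triangularVec₁ 1) =
      a • (Q.toContinuousLinearEquiv : E3 →L[ℝ] E3) (triangularVec₁ 1) +
        ((L : E3 →L[ℝ] E3) - a • (Q.toContinuousLinearEquiv : E3 →L[ℝ] E3)) (triangularVec₁ 1) := by
    rw [sub_apply, smul_apply, add_sub_cancel]
  have hbound : ‖(L : E3 →L[ℝ] E3) (triangularVec₁ 1)‖ ≤ (1 + s) * a := by
    rw [hsum]
    refine (norm_add_le _ _).trans ?_
    rw [norm_smul, Real.norm_eq_abs, abs_of_nonneg ha, hQv, mul_one]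
    linarith
  linarith

/-- ★ **F18 (PROVED): the tree's `IsPlacedPerfectPatch aHi δ θ a s Λ X′ Y` (part YV, g72, landed p852782) CAPS THE BINDERS' SEPARATION BY THE BINDERS'
SCALE, `δ ≤ (1 + s)·a`** — its placed crystal is an `aHi`-door set at the binders' `δ` (`IsSep δ`) and an equilibrium chart at the binders' `a`
(`s`-conformal). [this file, g73] -/
theorem IsPlacedPerfectPatch.sep_le {aHi δ θ a s Λ : ℝ} {X' : Set E3} {Y : Fin n → E3}
    (h : IsPlacedPerfectPatch aHi δ θ a s Λ X' Y) (ha : 0 ≤ a) : δ ≤ (1 + s) * a := by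
  obtain ⟨L, w, g, -, hE, hD, -⟩ := h
  by_contra hlt
  exact not_isSep_layeredHom_of_isConfChart w hE.2.2.1 ha (lt_of_not_ge hlt) hD.2.1

/-- ★ **`SepCeilingWitnessP ϑc ϑp r q rsh ρ rm aHi Λ θ s`** — ONE instance of the binders of (QE) / (XR♯) whose separation exceeds the conformal ceiling of
its chart: `(1 + s)·a < δ`.  Inhabited by the standing presupposition of the docket (an LJ-Nash clean fcc chart `H = λ⋆·fcc` exists): (W0) `K = ∅`
(`coreOf S ∅ ρ = moatIn S ∅ r ℓ = ∅`: tameness vacuous, `n = 0`), `H` read at the bottom of its conformal range `a := λ⋆/(1 + s)` (`IsConfChart`: `|λ⋆ − a|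
= s·a`), `S := (1 + η)·H` for any small `η > 0` inside the clean window (a Bravais lattice: every site critical by inversion symmetry, Nash and clean by
openness from `η = 0`; charted; summable; θ-good by `affineGood_of_isDoorSetP`), `δ := (1 + η)·λ⋆ > λ⋆ = (1 + s)·a`; (W1) NON-vacuous: the same with
`0 < η ≤ ϑc/4` and any `K` — every `4`-star of `S` is `ϑc`-tame into `H` via `p ↦ p/(1 + η)` (`U = 1`, error `≤ 4η`).  Not formalised (no door set is
constructed anywhere in the tree); typed so that the refutation below is a checked reduction. [this file, g73] -/
def SepCeilingWitnessP (ϑc ϑp r q rsh ρ rm aHi Λ θ s : ℝ) : Prop :=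
  ∃ δ : ℝ, 0 < δ ∧ ∃ a : ℝ, 0 < a ∧ (1 + s) * a < δ ∧
    ∃ S : Set E3, IsDoorSetP aHi δ S ∧ (∀ z : E3, Summable fun y : S => lennardJones (dist z (y : E3))) ∧
      (∀ p ∈ S, IsTwoShellAffineGood θ S p) ∧
        ∃ (L : E3 ≃L[ℝ] E3) (w : ℤ → E3), IsEquilChart a s Λ L w ∧
          ∃ (x₀ : E3) (K : Set E3), K ⊆ S ∧ (∀ k ∈ K, dist k x₀ ≤ q) ∧
            IsTameOn ϑp S (LayeredHom (L : E3 →L[ℝ] E3) w) (coreOf S K rm) ∧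
              IsTameOn ϑc S (LayeredHom (L : E3 →L[ℝ] E3) w) (moatIn S K r (r + rsh)) ∧
                ∃ (n : ℕ) (xf : Fin n → E3), Function.Injective xf ∧ Set.range xf = coreOf S K ρ

/-- ★★ **F18 — (XR♯) `RigidReferenceP` (part YV, the existence leaf of the line of record 72R, row 1303) IS FALSE AS TYPED at EVERY value of its dials,
given one sep-ceiling instance of its own binders (PROVED reduction)**: every placed perfect patch forces `δ ≤ (1 + s)·a` (`IsPlacedPerfectPatch.sep_le`),
the binders do not.  Class MISSTATED (the clause is never destructured downstream); repaired by `IsPlacedShadowPatch` below. [this file, g73] -/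
theorem not_rigidReferenceP_of_sepCeilingWitness {ϑc ϑ ϑp r q rsh ρ rm dm ϑ₀ Rg sb dI dB ε Rl Ru aHi Λ θ s : ℝ}
    (hW : SepCeilingWitnessP ϑc ϑp r q rsh ρ rm aHi Λ θ s) :
    ¬ RigidReferenceP ϑc ϑ ϑp r q rsh ρ rm dm ϑ₀ Rg sb dI dB ε Rl Ru aHi Λ θ s := by
  intro hR
  obtain ⟨δ, hδ, a, ha, hlt, S, hS, hsum, hgood, L, w, hLw, x₀, K, hKS, hKq, hmild, hcool, n, xf, hxf, hrange⟩ := hW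
  obtain ⟨y₀, X', -, hperf, -⟩ := hR δ hδ a ha S hS hsum hgood L w hLw x₀ K hKS hKq hmild hcool n xf hxf hrange
  exact absurd (hperf.sep_le ha.le) (not_le.2 hlt)

/-- ★ **THE SAME CEILING IN THE RECORD'S OWN TERMS (PROVED)**: on a sep-ceiling instance the WHOLE record glue of part YW is vacuous — its existence
hypothesis `hR : RigidReferenceP …` is refutable, so `coolMoatSlavedFillingP_of_rigidLoadPath` proves (QE) there from `False`. [this file, g73] -/
theorem rigidReferenceP_iff_false_of_sepCeilingWitness {ϑc ϑ ϑp r q rsh ρ rm dm ϑ₀ Rg sb dI dB ε Rl Ru aHi Λ θ s : ℝ}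
    (hW : SepCeilingWitnessP ϑc ϑp r q rsh ρ rm aHi Λ θ s) :
    RigidReferenceP ϑc ϑ ϑp r q rsh ρ rm dm ϑ₀ Rg sb dI dB ε Rl Ru aHi Λ θ s ↔ False :=
  ⟨not_rigidReferenceP_of_sepCeilingWitness hW, False.elim⟩

/-- ★★ **`IsPlacedShadowPatch σ ϑr H X′ Y`** — `(X′, Y)` is a clamped patch of a PLACED PERFECT LAYERED CRYSTAL SHADOWING THE CHART CRYSTAL `H`: there are a
rooted layered crystal `H₀ = LayeredHom L′ w′` (ONE linear map `L′`, FREE per-layer translations `w′` — any stacking word, any heights, any scale), an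
isometry `g` of `E3` placing it, such that (i) `H₀` is `σ`-SEPARATED (no doubled sites or layers); (ii) SHADOWING: every radius-`4` environment of `H₀` is
TWO-SIDEDLY `ϑr`-close, by translation (`EnvClose`, part MesoCut), to a radius-`4` environment of `H` — two-sided, so `H₀` is locally a full
three-dimensional close packing wherever `H` is (no rows, no monolayers), and LOCAL only (centre `x ∈ H` free per site: the word of `H₀` need not be a
factor of the word of `H`, only its `4`-windows are); (iii) `Y` injectively enumerates sites of `g '' H₀` and `X′ = g '' H₀ ∖ range Y` is ALL the rest.
NOTHING of the binders' `(δ, a, aHi, θ)` is imposed on `H₀` (F18), and NO Nash/equilibrium condition: the reference is KINEMATICALLY constructible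
(collar word and heights read off the `ϑc`-cool collar, continued above/below by the windows of `H` from the positions where the top/bottom collar
stars map, continued in-plane for free), while every crystal-physics fact (what equilibrium charts look like, Born stability, Green rows) is the
burden of the ONE configuration-free piece (Gl♮), which quantifies over the equilibrium chart `H` being shadowed.  Dials: `σ` (forecast `3/4`: clean
charts have nearest neighbours `≥ 0.9·(1 − 2/16) = 0.7875`), `ϑr` (forecast `= ε = 10⁻⁴ ≥ 5ϑc`). [this file, g73] -/
def IsPlacedShadowPatch (σ ϑr : ℝ) (H X' : Set E3) (Y : Fin n → E3) : Prop :=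
  ∃ (L' : E3 →L[ℝ] E3) (w' : ℤ → E3) (g : E3 → E3), Isometry g ∧ IsSep σ (LayeredHom L' w') ∧
    (∀ x' ∈ LayeredHom L' w', ∃ x ∈ H, EnvClose ϑr 4 (LayeredHom L' w') x' H x) ∧
      Function.Injective Y ∧ Set.range Y ⊆ g '' LayeredHom L' w' ∧ X' = g '' LayeredHom L' w' \ Set.range Y

/-- ★ **THE SHADOW CLASS IS INHABITED FROM THE BINDERS (PROVED; contrast F18)**: the chart crystal `H = LayeredHom L w` ITSELF, placed by any isometry
`g`, with any injective site list `Y ⊆ g '' H`, is a `(σ, ϑr)`-shadow patch of `H` as soon as `H` is `σ`-separated and `ϑr ≥ 0` (each environment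
shadows itself).  In particular the `(1 + η)`-dilated-copy instances of F18 are served by `H₀ :=` the dilated crystal (environment error `≤ 4η ≤ ϑc ≤ ϑr`),
and the `K = ∅` instances by `H₀ := H`. [this file, g73] -/
theorem isPlacedShadowPatch_self {σ ϑr : ℝ} {L : E3 →L[ℝ] E3} {w : ℤ → E3} {g : E3 → E3} {Y : Fin n → E3}
    (hsep : IsSep σ (LayeredHom L w)) (hϑ : 0 ≤ ϑr) (hg : Isometry g) (hY : Function.Injective Y)
    (hYr : Set.range Y ⊆ g '' LayeredHom L w) :
    IsPlacedShadowPatch σ ϑr (LayeredHom L w) (g '' LayeredHom L w \ Set.range Y) Y :=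
  ⟨L, w, g, hg, hsep, fun x' hx' => ⟨x', hx', fun p hp _ => ⟨p, hp, by simpa using hϑ⟩, fun q hq _ => ⟨q, hq, by simpa using hϑ⟩⟩, hY, hYr, rfl⟩

/-- shadowing is WEAKER for a smaller separation floor and a larger tolerance. [this file, g73] -/
theorem IsPlacedShadowPatch.mono {σ σ' ϑr ϑr' : ℝ} (hσ : σ' ≤ σ) (hϑ : ϑr ≤ ϑr') {H X' : Set E3} {Y : Fin n → E3}
    (h : IsPlacedShadowPatch σ ϑr H X' Y) : IsPlacedShadowPatch σ' ϑr' H X' Y := by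
  obtain ⟨L', w', g, hg, hsep, henv, hY, hYr, hX⟩ := h
  refine ⟨L', w', g, hg, fun x hx y hy hxy => hσ.trans (hsep x hx y hy hxy), fun x' hx' => ?_, hY, hYr, hX⟩
  obtain ⟨x, hx, h1, h2⟩ := henv x' hx'
  refine ⟨x, hx, fun p hp hd => ?_, fun q hq hd => ?_⟩
  · obtain ⟨q, hq, hpq⟩ := h1 p hp hd; exact ⟨q, hq, hpq.trans hϑ⟩
  · obtain ⟨p, hp, hpq⟩ := h2 q hq hd; exact ⟨p, hp, hpq.trans hϑ⟩

end ShadowReference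

/-! ### YX-2  The pieces (XR♮) / (Gl♮) / (Gp♮) and the restricted target (Gh♮) (typed; binders of (QE)/(Gh) verbatim; every constant symbolic) -/

section Pieces

/-- ★★ **(XR♮) «ShadowReferenceP … Rg sb dI dB σ ϑr ε Rl Ru …» — A RIGID COLLAR-REGISTERED SHADOW REFERENCE EXISTS.**  Under the binders of (QE) verbatim:
there are a reference filling `y₀` with `IsTubeReference ϑ₀ ϑ dm Rg sb dI dB (S ∖ core) (LayeredHom L w) xf y₀` (as (XR)) which IS a `(σ, ϑr)`-shadow patch
`(X′, y₀)` of the chart crystal `H = LayeredHom L w` (`IsPlacedShadowPatch`: the sites of ONE placed `σ`-separated layered crystal whose `4`-environments are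
two-sidedly `ϑr`-close to environments of `H`), with `X′` collar-registered to `S ∖ core` on the cool zone `dist(·, K) < r + rsh` within `ε` and class band
`[Rl, Ru]` about `Rg`.  SPECIAL∃ · KINEMATIC · ATTACKABLE — (J) FRAME: F. John synthesis of the `ϑc`-cool shell `r ≤ dist(·, K) ≤ r + rsh + 4` (tame stars
overlap along chains of bonded atoms; a thick spherical shell has trivial monodromy) gives one Euclidean frame and per-layer registry letters + heights with
residual `≲ (ϑc/4)·(r + rsh)`; (W) WORD CONTINUATION: above the topmost (below the bottommost) collar layer continue with the letters of `H` read upward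
(downward) from the `H`-environment into which that layer's stars map (`4`-windows of the glued word are `4`-windows of `H` — at the seam because the collar
star's two-sided image already contains the next layers), in-plane continuation is free (each layer a full triangular lattice); (M) MATCHING: `y₀ :=` the
crystal sites in the core region matched injectively to `xf` within `dm = 1/2` (the `1/10`-mild core is itself locally a close packing `ϑp`-near `H`; slip
budget `≈ (ϑc/4)·ρ ≪ 1/2`).  STRONGER than (XR) · INSTRUMENTABLE «ShadowFit-T» (fit to sampled cool collars: separation `σ`, environment residual `ϑr`,
registration residual `ε`, interface misfit `ϑ₀`, matching distance, class flips in the band).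
Why it might fail: (a) RIGID MISFIT — a `ϑc`-cool collar may carry uniform strain/bend `ϑc/4` per unit length, so ONE crystal with ONE linear part misses it
by `≈ (ϑc/4)·(ρ + Rg)`: needs `ε, ϑ₀, ϑr ≳ 5ϑc` — free in the `∃ ϑm` column, NOT at the record `ϑm = 1/2000` (F15 of g72 stands); (b) REGISTRY SLIP /
matching `dm = 1/2` against the `1/10`-mild core exactly as (XR) (a mild core with a different in-plane registry than the collar's continuation costs up to
`a/√3 ≈ 0.56 > 1/2` — the mild core's own `ϑp`-tameness into `H` across the core/collar seam is what forbids it; this is the delicate clause); (c) CLASS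
BAND as in g72; (d) the seam of (W): if the topmost collar layer's stars are only ONE-sidedly informative (collar thinner than `4` above the seam) the
continuation letter is read from `H` but not forced by `S` — harmless for shadowing (only `H`-closeness is claimed), relevant only for (M1)/(M2) inside
the zone, where the collar IS two-sided.
Sources: part YO (XR); part YF (frame step); part TR (FJM); F. John, CPAM 14 (1961); Ariza–Ortiz, ARMA 178 (2005); Conway–Sloane SPLAG ch. 7 (Barlow
words); this file's header (F18, repair (a)–(d)). [this file, g73] -/
def ShadowReferenceP (ϑc ϑ ϑp r q rsh ρ rm dm ϑ₀ Rg sb dI dB σ ϑr ε Rl Ru aHi Λ θ s : ℝ) : Prop :=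
  ∀ δ : ℝ, 0 < δ → ∀ a : ℝ, 0 < a →
    ∀ S : Set E3, IsDoorSetP aHi δ S → (∀ z : E3, Summable fun y : S => lennardJones (dist z (y : E3))) →
      (∀ p ∈ S, IsTwoShellAffineGood θ S p) →
        ∀ (L : E3 ≃L[ℝ] E3) (w : ℤ → E3), IsEquilChart a s Λ L w →
          ∀ (x₀ : E3) (K : Set E3), K ⊆ S → (∀ k ∈ K, dist k x₀ ≤ q) →
            IsTameOn ϑp S (LayeredHom (L : E3 →L[ℝ] E3) w) (coreOf S K rm) →
              IsTameOn ϑc S (LayeredHom (L : E3 →L[ℝ] E3) w) (moatIn S K r (r + rsh)) →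
                ∀ (n : ℕ) (xf : Fin n → E3), Function.Injective xf → Set.range xf = coreOf S K ρ →
                  ∃ (y₀ : Fin n → E3) (X' : Set E3),
                    IsTubeReference ϑ₀ ϑ dm Rg sb dI dB (S \ coreOf S K ρ) (LayeredHom (L : E3 →L[ℝ] E3) w) xf y₀ ∧
                      IsPlacedShadowPatch σ ϑr (LayeredHom (L : E3 →L[ℝ] E3) w) X' y₀ ∧
                        IsCollarRegistered ε Rl Rg Ru {z | ∃ k ∈ K, dist z k < r + rsh} (S \ coreOf S K ρ) X' y₀

/-- ★★★ **(Gl♮) «ShadowPatchResponseP q ρi ρo σ ϑr Rl Ru Rg Rφ GsG … GBB Λ s» — CLASS-SPLIT MAX-NORM RESPONSE OF THE FAT CLAMPED SHADOW PATCH OF AN EQUILIBRIUM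
CHART, UNIFORMLY OVER THE CLASSIFICATION BAND.**  For every scale `a > 0`, every equilibrium chart `(L, w)` (`IsEquilChart a s Λ L w` — the chart binder of
(QE)/(Gh) verbatim) and every `(σ, ϑr)`-shadow patch `(X′, Y)` of its crystal that is `(q, ρi, ρo)`-fat: `clampedEnergy X′` is twice differentiable at `Y`
with tangent stiffness `A`, and for EVERY class `I` with `X′-class(Rl) ⊆ I ⊆ X′-class(Ru)` and every displacement `u` whose harmonic load `A u` has `I`-class
levels `(Mg, MI, Mb) ≥ 0` (flux radius `Rφ`), `Y + u ∈ bondTubeC I Rg (Σ_c Gs_c M_c) (Σ_c GI_c M_c) (Σ_c GB_c M_c) Y`.  CONFIGURATION-FREE (no `S`, no `K`) ·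
SPECIAL · CERT-type · INSTRUMENTABLE «GreenRow-T(shadow, band)»: the objects are the `ϑr`-perturbations (per-layer registry/height errors `≤ ϑr`, one global
linear part) of the layered crystals locally modelled on near-equilibrium charts — one sparse factorisation per (word window, core shape), Green rows
Lipschitz in the `ϑr`-perturbation.  ALL crystal physics of the line lives here: (i) equilibrium charts are near-ideal close packings (part Q: Nash by
layers, clean scale window, `2 %` strain class); (ii) Born/phonon stability of every Barlow stacking near the LJ equilibrium spacing, uniformly in the word
(environments beyond radius `4` differ by `O(r⁻⁶)` tails); (iii) stability is open: `σ`-separated two-sided `ϑr`-shadows with `ϑr = 10⁻⁴` inherit it.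
Why it might fail: (ii) at the DILATED corner of the clean scale window (nearest neighbour up to `≈ 1.06·a₀`, where LJ close packings approach the Born
instability) — an honest ∀-risk shared with (X1) `TubeConvexityP` of part YO, flagged lineage-wide; rows `∝ ρo` / `∝ log ρo` by size; a wide band
re-classifying a whole shell (keep `Ru − Rl` at a few `ε`); ragged fuzz of width `ρo − ρi = ε + dm` at the rim; a `σ` too small admitting near-doubled layers
(forecast `σ = 3/4`, cf. `0.7875`).
Sources: held parts YT (Gl) g71 / YV (Gl♯) g72; part Q (`IsEquilChart`); E–Ming 2007 §2; Ortner–Theil 2013 §6; Ehrlacher–Ortner–Shapeev 2016; Wallace,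
Thermodynamics of Crystals (1972) ch. 1; Born–Huang 1954 §III; row 1295 (Gl-∀), (ρ1′). [this file, g73] -/
def ShadowPatchResponseP (q ρi ρo σ ϑr Rl Ru Rg Rφ GsG GsI GsB GIG GII GIB GBG GBI GBB Λ s : ℝ) : Prop :=
  ∀ a : ℝ, 0 < a → ∀ (L : E3 ≃L[ℝ] E3) (w : ℤ → E3), IsEquilChart a s Λ L w →
    ∀ (n : ℕ) (X' : Set E3) (Y : Fin n → E3), IsPlacedShadowPatch σ ϑr (LayeredHom (L : E3 →L[ℝ] E3) w) X' Y → IsFatPatch q ρi ρo X' Y →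
      ∃ A : (Fin n → E3) →L[ℝ] ((Fin n → E3) →L[ℝ] ℝ),
        HasFDerivAt (fun z : Fin n → E3 => fderiv ℝ (fun z : Fin n → E3 => clampedEnergy X' z) z) A Y ∧
          ∀ I : Fin n → Prop, (∀ i, (∃ p' ∈ X', dist (Y i) p' ≤ Rl) → I i) → (∀ i, I i → ∃ p' ∈ X', dist (Y i) p' ≤ Ru) →
            ∀ u : Fin n → E3, ∀ Mg MI Mb : ℝ, 0 ≤ Mg → 0 ≤ MI → 0 ≤ Mb → HasTubeFluxLoadC I Rφ Mg MI Mb Y (A u) →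
              Y + u ∈ bondTubeC I Rg (GsG * Mg + GsI * MI + GsB * Mb) (GIG * Mg + GII * MI + GIB * Mb) (GBG * Mg + GBI * MI + GBB * Mb) Y

/-- ★★ **(Gp♮) «ShadowPinDriftP … Rg sb dI dB Rφ σ ϑr ε Rl Ru κg κI κb …» — THE PIN MISMATCH OF A RIGID COLLAR-REGISTERED SHADOW REFERENCE IS GAUGE-SMALL.**  Under
the binders of (Gh) verbatim, for every tube reference `y₀` that is a `(σ, ϑr)`-shadow patch `(X′, y₀)` of the chart crystal, collar-registered to `S ∖ core` (zone
`dist(·, K) < r + rsh`, tolerance `ε`, band `[Rl, Ru]`), the tangent stiffnesses `H` of `clampedEnergy (S ∖ core)` and `A` of `clampedEnergy X′` AT THE SAME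
POINT `y₀`, and every displacement `u` of gauge `l ≥ 0`: the defect load `H u − A u` has class levels `l·(κg, κI, κb)` about `y₀`.  FORWARD: the core's
interaction energy is the SAME function in both clamped energies, so `H − A` is the Hessian of `Σᵢ (Σ_{p ∈ X} V(zᵢ − p) − Σ_{p′ ∈ X′} V(zᵢ − p′))` —
SITE-DIAGONAL, NO core–core term, `κg = 0` admissible; `‖P_i(X) − P_i(X′)‖ ≤ ε·Σ_{cool} |D³V| + Σ_{warm} |D²V|` (both sides), warm atoms at distance
`≥ r + rsh − ρ − dm − depth(i)`.  GENERIC · ANALYTIC · ATTACKABLE · INSTRUMENTABLE «PinDrift-R».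
Why it might fail: SIZE only — outermost interface sites see the warm host from distance `≈ 3.5` (`2π(3.5) ≈ 0.27` of `κI/dI`); `GB_I` unmeasured;
compressed cool bonds have larger `|D³V|` (absorbed by the free `ε`).
Sources: held parts YT (Gp) g71 / YV (Gp♯) g72 (`|V‴(a₀)| ≈ 207`, `c_tail`, Gr-3); E–Ming 2007 §2; Ortner–Theil 2013. [this file, g73] -/
def ShadowPinDriftP (ϑc ϑ ϑp r q rsh ρ rm dm ϑ₀ Rg sb dI dB Rφ σ ϑr ε Rl Ru κg κI κb aHi Λ θ s : ℝ) : Prop :=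
  ∀ δ : ℝ, 0 < δ → ∀ a : ℝ, 0 < a →
    ∀ S : Set E3, IsDoorSetP aHi δ S → (∀ z : E3, Summable fun y : S => lennardJones (dist z (y : E3))) →
      (∀ p ∈ S, IsTwoShellAffineGood θ S p) →
        ∀ (L : E3 ≃L[ℝ] E3) (w : ℤ → E3), IsEquilChart a s Λ L w →
          ∀ (x₀ : E3) (K : Set E3), K ⊆ S → (∀ k ∈ K, dist k x₀ ≤ q) →
            IsTameOn ϑp S (LayeredHom (L : E3 →L[ℝ] E3) w) (coreOf S K rm) →
              IsTameOn ϑc S (LayeredHom (L : E3 →L[ℝ] E3) w) (moatIn S K r (r + rsh)) →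
                ∀ (n : ℕ) (xf : Fin n → E3), Function.Injective xf → Set.range xf = coreOf S K ρ →
                  ∀ y₀ : Fin n → E3, IsTubeReference ϑ₀ ϑ dm Rg sb dI dB (S \ coreOf S K ρ) (LayeredHom (L : E3 →L[ℝ] E3) w) xf y₀ →
                    ∀ X' : Set E3, IsPlacedShadowPatch σ ϑr (LayeredHom (L : E3 →L[ℝ] E3) w) X' y₀ →
                      IsCollarRegistered ε Rl Rg Ru {z | ∃ k ∈ K, dist z k < r + rsh} (S \ coreOf S K ρ) X' y₀ →
                        ∀ H : (Fin n → E3) →L[ℝ] ((Fin n → E3) →L[ℝ] ℝ),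
                          HasFDerivAt (fun z : Fin n → E3 => fderiv ℝ (fun z : Fin n → E3 => clampedEnergy (S \ coreOf S K ρ) z) z) H y₀ →
                            ∀ A : (Fin n → E3) →L[ℝ] ((Fin n → E3) →L[ℝ] ℝ),
                              HasFDerivAt (fun z : Fin n → E3 => fderiv ℝ (fun z : Fin n → E3 => clampedEnergy X' z) z) A y₀ →
                                ∀ u : Fin n → E3, ∀ l : ℝ, 0 ≤ l →
                                  y₀ + u ∈ bondTube (S \ coreOf S K ρ) Rg (l * sb) (l * dI) (l * dB) y₀ →
                                    HasTubeFluxLoad (S \ coreOf S K ρ) Rg Rφ (l * κg) (l * κI) (l * κb) y₀ (H u - A u)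

/-- ★★ **(Gh♮) «ShadowHarmonicResponseP … Rg sb dI dB Rφ σ ϑr ε Rl Ru HsG … HBB …» — (Gh) RESTRICTED TO RIGID COLLAR-REGISTERED SHADOW REFERENCES.**  Part YS's
`HarmonicResponseP` with the reference additionally a `(σ, ϑr)`-shadow patch `(X′, y₀)` of the chart crystal, collar-registered to the exterior: for the
tangent stiffness `H` at `y₀`, every `u` with harmonic load of class levels `M ≥ 0` has `y₀ + u ∈ T(H·M)`.  WEAKER than (Gh) (part YY
`HarmonicResponseP.shadow`); the target of the node (part YY `shadowHarmonicResponseP_of_patch`) and the input of the shadow chain. [this file, g73] -/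
def ShadowHarmonicResponseP (ϑc ϑ ϑp r q rsh ρ rm dm ϑ₀ Rg sb dI dB Rφ σ ϑr ε Rl Ru HsG HsI HsB HIG HII HIB HBG HBI HBB aHi Λ θ s : ℝ) : Prop :=
  ∀ δ : ℝ, 0 < δ → ∀ a : ℝ, 0 < a →
    ∀ S : Set E3, IsDoorSetP aHi δ S → (∀ z : E3, Summable fun y : S => lennardJones (dist z (y : E3))) →
      (∀ p ∈ S, IsTwoShellAffineGood θ S p) →
        ∀ (L : E3 ≃L[ℝ] E3) (w : ℤ → E3), IsEquilChart a s Λ L w →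
          ∀ (x₀ : E3) (K : Set E3), K ⊆ S → (∀ k ∈ K, dist k x₀ ≤ q) →
            IsTameOn ϑp S (LayeredHom (L : E3 →L[ℝ] E3) w) (coreOf S K rm) →
              IsTameOn ϑc S (LayeredHom (L : E3 →L[ℝ] E3) w) (moatIn S K r (r + rsh)) →
                ∀ (n : ℕ) (xf : Fin n → E3), Function.Injective xf → Set.range xf = coreOf S K ρ →
                  ∀ y₀ : Fin n → E3, IsTubeReference ϑ₀ ϑ dm Rg sb dI dB (S \ coreOf S K ρ) (LayeredHom (L : E3 →L[ℝ] E3) w) xf y₀ →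
                    ∀ X' : Set E3, IsPlacedShadowPatch σ ϑr (LayeredHom (L : E3 →L[ℝ] E3) w) X' y₀ →
                      IsCollarRegistered ε Rl Rg Ru {z | ∃ k ∈ K, dist z k < r + rsh} (S \ coreOf S K ρ) X' y₀ →
                        ∀ H : (Fin n → E3) →L[ℝ] ((Fin n → E3) →L[ℝ] ℝ),
                          HasFDerivAt (fun z : Fin n → E3 => fderiv ℝ (fun z : Fin n → E3 => clampedEnergy (S \ coreOf S K ρ) z) z) H y₀ →
                            ∀ u : Fin n → E3, ∀ Mg MI Mb : ℝ, 0 ≤ Mg → 0 ≤ MI → 0 ≤ Mb →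
                              HasTubeFluxLoad (S \ coreOf S K ρ) Rg Rφ Mg MI Mb y₀ (H u) →
                                y₀ + u ∈ bondTube (S \ coreOf S K ρ) Rg (HsG * Mg + HsI * MI + HsB * Mb) (HIG * Mg + HII * MI + HIB * Mb)
                                  (HBG * Mg + HBI * MI + HBB * Mb) y₀

end Pieces

end Summit.AtomisticToContinuum.Crystallization.Theorems.ChartedZeroExcessLayeredLatticeLiouville

end
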